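import Mathlib
import Summits.CriticalPhenomena.Ising3DConformalLimit.Theses.BernsteinTemperature
import Summits.CriticalPhenomena.Ising3DConformalLimit.Theorems.BernsteinTemperatureKernelTransferEdge
import Summits.CriticalPhenomena.Ising3DConformalLimit.Theorems.BernsteinTemperatureKernelTransferStep
import Summits.CriticalPhenomena.Ising3DConformalLimit.Theorems.BernsteinTemperatureKernelTransferBound
import HarnessLib

/-!
# `KernelTransfer` (route BernsteinTemperature, item stmt-CriticalPhenomena-8360): PROOF

`AbsMonotoneTanh → KernelLocalLimit → IsingEuclidUpgradeR2RotInvPowerLaw`: if the plus-state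
two-point functions of the nearest-neighbour Ising model on `ℤ³` are power series in `v = tanh β`
with non-negative coefficients `a_n(x)` on `[0, β_c)` (AM), and the high-temperature kernels
`a_n(x)/Σ_y a_n(y)` have an isotropic local limit with pure-power regularly varying totals and
polynomial tails (KLL), then the critical two-point function is asymptotically a rotation-invariant
pure power law, `⟨σ₀σ_x⟩_{β_c} |x|₂^{2Δ} → c > 0` along the cofinite filter, with `2Δ = 3 - γ/ν`
(Fisher's relation) and `c = C ∫₀^∞ u^{γ-1-3ν} Q(u^{-ν}) du`.

* `KernelTransfer.abelian_tendsto` — the analytic core (Abelian summation with a local limit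
  theorem), in the abstract setting of `…KernelTransferBound` (index set `X`, filter `l`, radius
  `r x → ∞`, parity `m x`, coefficients `a x n ≥ 0` with totals `S n`, edge variable `v ≥ 0`): the
  hypotheses of `KernelLocalLimit` give `(Σ_n a x n vⁿ) · (r x)^{3-γ/ν} → c > 0` along `l`. The
  series is the integral over `(0,∞)` of the step function of `…KernelTransferStep`
  (`integral_step_eq_tsum`); dominated convergence with the majorant of `…KernelTransferBound`
  (`term_le_phi`, `phi_le_psi`, `integrableOn_psi`) and the pointwise limit
  `tendsto_step_pointwise`; `c > 0` by continuity of the limit profile and `Q ≢ 0`.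
* `kernelTransfer_proof` — literally the route decl: the edge identity
  `⟨σ₀σ_x⟩_{β_c} = Σ_n a_n(x) v_cⁿ` for `x ≠ 0` (`hasSum_criticalTwoPoint_of_hasSum_below`, file
  `…KernelTransferEdge`: monotone convergence, left-continuity of the free state,
  `⟨·⟩⁺_{β_c} = ⟨·⟩^∅_{β_c}` on pairs in `d = 3`) feeds `abelian_tendsto` on the cofinite filter of
  `ℤ³` with `r x = |x|₂`, `m x = |x|₁`, `S n = Σ_y a_n(y)`, `v = tanh β_c`.
No definitions are introduced; no named fact is assumed (axioms `propext`, `Classical.choice`,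
`Quot.sound`).
-/

noncomputable section

namespace Summit.CriticalPhenomena.Ising3DConformalLimit.Theorems

open Filter Topology MeasureTheory Set
open Literature.Probability.LatticeModels

section Core

variable {X : Type*}

/-- **Abelian summation with a local limit theorem.** See the module docstring. The exponent `p`
of the tail bound is only required to exceed `3 - γ/ν` (it is lowered inside the proof so that the
small-`u` exponent `γ-1-3ν+νp` of the majorant lies in `(-1, 0]`). -/
theorem KernelTransfer.abelian_tendsto {l : Filter X} [l.IsCountablyGenerated] [l.NeBot]
    {r : X → ℝ} {m : X → ℕ} {a : X → ℕ → ℝ} {S : ℕ → ℝ} {v ν γ C A p : ℝ} {Q : ℝ → ℝ}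
    (hν : 0 < ν) (hγ : γ < 3 * ν) (hC : 0 < C) (hA : 0 < A) (hp : 3 - γ / ν < p)
    (hQc : ContinuousOn Q (Ici 0)) (hQ0 : ∀ s, 0 ≤ s → 0 ≤ Q s) (hQpos : ∃ s, 0 ≤ s ∧ 0 < Q s)
    (hv : 0 ≤ v) (hr0 : ∀ x, 0 ≤ r x) (hr : Tendsto r l atTop)
    (ha0 : ∀ x n, 0 ≤ a x n) (haS : ∀ x n, a x n ≤ S n)
    (hpar : ∀ x n, ¬ Even (n + m x) → a x n = 0) (hzero : ∀ᶠ x in l, a x 0 = 0)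
    (hsum : ∀ᶠ x in l, Summable fun n => a x n * v ^ n)
    (hRV : Tendsto (fun n : ℕ => v ^ n * S n / (n : ℝ) ^ (γ - 1)) atTop (𝓝 C))
    (hLL : ∀ R ε : ℝ, 0 < R → 0 < ε → ∀ᶠ n : ℕ in atTop, ∀ x, r x ≤ R * (n : ℝ) ^ ν →
      Even (n + m x) → |(n : ℝ) ^ (3 * ν) * a x n / (2 * S n) - Q (r x / (n : ℝ) ^ ν)| ≤ ε)
    (htail : ∀ (x : X) (n : ℕ), 1 ≤ n →
      (n : ℝ) ^ (3 * ν) * a x n / S n ≤ A * (1 + r x / (n : ℝ) ^ ν) ^ (-p)) :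
    ∃ c : ℝ, 0 < c ∧
      Tendsto (fun x => (∑' n, a x n * v ^ n) * r x ^ (3 - γ / ν)) l (𝓝 c) := by
  -- exponents; lower `p` so that the small-`u` exponent is in `(-1, 0]`
  have hγν : γ / ν < 3 := by rwa [div_lt_iff₀ hν]
  obtain ⟨p', hp'1, hp'2, hp'3⟩ : ∃ p', 3 - γ / ν < p' ∧ p' < 3 - γ / ν + 1 / ν ∧ p' ≤ p :=
    ⟨min p (3 - γ / ν + 1 / (2 * ν)),
      lt_min hp (by have := one_div_pos.2 (mul_pos two_pos hν); linarith),
      (min_le_right _ _).trans_lt (by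
        have h1 : 1 / (2 * ν) < 1 / ν := one_div_lt_one_div_of_lt hν (by linarith)
        linarith),
      min_le_left _ _⟩
  have hp'0 : 0 ≤ p' := by linarith
  have he₂ : γ - 1 - 3 * ν < -1 := by linarith
  have he₂0 : γ - 1 - 3 * ν ≤ 0 := by linarith
  have hνκ : ν * (3 - γ / ν) = 3 * ν - γ := by field_simp
  have he₁ : -1 < γ - 1 - 3 * ν + ν * p' := by nlinarith [mul_lt_mul_of_pos_left hp'1 hν]
  have he₁0 : γ - 1 - 3 * ν + ν * p' ≤ 0 := by
    have h := mul_lt_mul_of_pos_left hp'2 hν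
    rw [mul_add, hνκ, mul_one_div_cancel hν.ne'] at h
    linarith
  -- the tail bound with `p'`
  have htail' : ∀ (x : X) (n : ℕ), 1 ≤ n →
      (n : ℝ) ^ (3 * ν) * a x n / S n ≤ A * (1 + r x / (n : ℝ) ^ ν) ^ (-p') := by
    intro x n hn
    refine (htail x n hn).trans (mul_le_mul_of_nonneg_left ?_ hA.le)
    exact Real.rpow_le_rpow_of_exponent_le (by
      have : 0 ≤ r x / (n : ℝ) ^ ν := div_nonneg (hr0 x) (Real.rpow_nonneg (Nat.cast_nonneg _) _)
      linarith) (by linarith)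
  -- the growth constant
  obtain ⟨C₁, hC₁0, hC₁⟩ := KernelTransfer.exists_growth_bound hRV
  -- the step functions, the limit profile and the majorant
  obtain ⟨F, hF⟩ : ∃ F : X → ℝ → ℝ, ∀ x u, F x u = r x ^ (3 - γ / ν) * (r x ^ (1 / ν) / 2 *
      (a x (2 * ⌊u * r x ^ (1 / ν) / 2⌋₊) * v ^ (2 * ⌊u * r x ^ (1 / ν) / 2⌋₊) +
        a x (2 * ⌊u * r x ^ (1 / ν) / 2⌋₊ + 1) * v ^ (2 * ⌊u * r x ^ (1 / ν) / 2⌋₊ + 1))) :=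
    ⟨_, fun _ _ => rfl⟩
  obtain ⟨f, hf⟩ : ∃ f : ℝ → ℝ, ∀ u, f u = C * u ^ (γ - 1 - 3 * ν) * Q (u ^ (-ν)) :=
    ⟨_, fun _ => rfl⟩
  obtain ⟨bound, hbound⟩ : ∃ bound : ℝ → ℝ, ∀ u, bound u = A * C₁ *
      (if u ≤ 3 then (u / 3) ^ (γ - 1 - 3 * ν + ν * p') else (u / 3) ^ (γ - 1 - 3 * ν)) :=
    ⟨_, fun _ => rfl⟩
  -- (i) measurability
  have hmeas : ∀ x, AEStronglyMeasurable (F x) (volume.restrict (Ioi 0)) := by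
    intro x
    rw [show F x = fun u => r x ^ (3 - γ / ν) * (r x ^ (1 / ν) / 2 *
      ((fun n => a x n * v ^ n) (2 * ⌊u * r x ^ (1 / ν) / 2⌋₊) +
        (fun n => a x n * v ^ n) (2 * ⌊u * r x ^ (1 / ν) / 2⌋₊ + 1))) from funext (hF x)]
    exact ((KernelTransfer.measurable_step (fun n => a x n * v ^ n)
      (r x ^ (1 / ν))).const_mul _).aestronglyMeasurable
  -- (ii) domination
  have hdom : ∀ᶠ x in l, ∀ u, 0 < u → ‖F x u‖ ≤ bound u := by
    filter_upwards [hr.eventually_gt_atTop 0, hzero] with x hrx hx0 u hu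
    have hL : 0 < r x ^ (1 / ν) := Real.rpow_pos_of_pos hrx _
    have hψ0 := KernelTransfer.psi_nonneg (ν := ν) (p := p') (e₂ := γ - 1 - 3 * ν) hu
    have key : ∀ n : ℕ, 2 * ⌊u * r x ^ (1 / ν) / 2⌋₊ ≤ n → n ≤ 2 * ⌊u * r x ^ (1 / ν) / 2⌋₊ + 1 →
        r x ^ (3 - γ / ν) * (r x ^ (1 / ν) / 2 * (a x n * v ^ n)) ≤ A * C₁ / 2 *
          (if u ≤ 3 then (u / 3) ^ (γ - 1 - 3 * ν + ν * p') else (u / 3) ^ (γ - 1 - 3 * ν)) := by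
      intro n hlo hhi
      rcases Nat.eq_zero_or_pos n with h0 | hpos
      · subst h0
        rw [hx0, zero_mul, mul_zero, mul_zero]
        positivity
      · refine (KernelTransfer.term_le_phi hrx hν hpos (ha0 x n) (haS x n) hv hA.le
          (htail' x n hpos)
          (hC₁ n hpos)).trans ?_
        exact mul_le_mul_of_nonneg_left
          (KernelTransfer.phi_le_psi hu (KernelTransfer.div_three_le_div hL hpos hlo) hp'0 he₂0 he₁0)
          (by positivity)
    have hF0 : 0 ≤ F x u := by
      rw [hF]
      exact mul_nonneg (Real.rpow_nonneg hrx.le _) (mul_nonneg (by positivity)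
        (add_nonneg (mul_nonneg (ha0 _ _) (pow_nonneg hv _))
          (mul_nonneg (ha0 _ _) (pow_nonneg hv _))))
    rw [Real.norm_eq_abs, abs_of_nonneg hF0, hF, hbound]
    have h1 := key (2 * ⌊u * r x ^ (1 / ν) / 2⌋₊) le_rfl (Nat.le_succ _)
    have h2 := key (2 * ⌊u * r x ^ (1 / ν) / 2⌋₊ + 1) (Nat.le_succ _) le_rfl
    calc r x ^ (3 - γ / ν) * (r x ^ (1 / ν) / 2 *
          (a x (2 * ⌊u * r x ^ (1 / ν) / 2⌋₊) * v ^ (2 * ⌊u * r x ^ (1 / ν) / 2⌋₊) +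
            a x (2 * ⌊u * r x ^ (1 / ν) / 2⌋₊ + 1) * v ^ (2 * ⌊u * r x ^ (1 / ν) / 2⌋₊ + 1)))
        = r x ^ (3 - γ / ν) * (r x ^ (1 / ν) / 2 *
            (a x (2 * ⌊u * r x ^ (1 / ν) / 2⌋₊) * v ^ (2 * ⌊u * r x ^ (1 / ν) / 2⌋₊))) +
          r x ^ (3 - γ / ν) * (r x ^ (1 / ν) / 2 *
            (a x (2 * ⌊u * r x ^ (1 / ν) / 2⌋₊ + 1) * v ^ (2 * ⌊u * r x ^ (1 / ν) / 2⌋₊ + 1))) := by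
          ring
      _ ≤ _ := add_le_add h1 h2
      _ = _ := by ring
  -- (iii) integrability of the majorant
  have hbint : IntegrableOn bound (Ioi 0) := by
    rw [show bound = fun u => A * C₁ *
      (if u ≤ 3 then (u / 3) ^ (γ - 1 - 3 * ν + ν * p') else (u / 3) ^ (γ - 1 - 3 * ν))
      from funext hbound]
    exact (KernelTransfer.integrableOn_psi he₁ he₂).const_mul (A * C₁)
  -- (iv) pointwise limit
  have hlim : ∀ u, 0 < u → Tendsto (fun x => F x u) l (𝓝 (f u)) := by
    intro u hu
    rw [hf]
    simp only [hF]
    exact KernelTransfer.tendsto_step_pointwise hν hC hQc hr hpar hRV hLL hu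
  -- dominated convergence
  have hT : Tendsto (fun x => ∫ u in Ioi 0, F x u) l (𝓝 (∫ u in Ioi 0, f u)) := by
    refine tendsto_integral_filter_of_dominated_convergence bound (Eventually.of_forall hmeas)
      ?_ hbint ?_
    · filter_upwards [hdom] with x hx
      exact (ae_restrict_iff' measurableSet_Ioi).2 (ae_of_all _ fun u hu => hx u hu)
    · exact (ae_restrict_iff' measurableSet_Ioi).2 (ae_of_all _ fun u hu => hlim u hu)
  -- the integral of the step function is the rescaled series
  have hint : ∀ᶠ x in l, ∫ u in Ioi 0, F x u = r x ^ (3 - γ / ν) * ∑' n, a x n * v ^ n := by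
    filter_upwards [hr.eventually_gt_atTop 0, hsum] with x hrx hsx
    have hL : 0 < r x ^ (1 / ν) := Real.rpow_pos_of_pos hrx _
    have h := (KernelTransfer.integral_step_eq_tsum
      (fun n => mul_nonneg (ha0 x n) (pow_nonneg hv n)) hsx hL).2
    simp only [hF]
    rw [integral_const_mul, h]
  -- the limit profile: non-negative, continuous, integrable, positive somewhere
  have hf0 : ∀ u, 0 < u → 0 ≤ f u := fun u hu => by
    rw [hf]
    exact mul_nonneg (mul_nonneg hC.le (Real.rpow_nonneg hu.le _))
      (hQ0 _ (Real.rpow_nonneg hu.le _))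
  have hfc : ContinuousOn f (Ioi 0) := by
    rw [show f = fun u => C * u ^ (γ - 1 - 3 * ν) * Q (u ^ (-ν)) from funext hf]
    exact KernelTransfer.continuousOn_profile hQc
  have hfint : IntegrableOn f (Ioi 0) := by
    refine Integrable.mono' hbint (hfc.aestronglyMeasurable measurableSet_Ioi) ?_
    refine (ae_restrict_iff' measurableSet_Ioi).2 (ae_of_all _ fun u hu => ?_)
    exact le_of_tendsto ((continuous_norm.tendsto _).comp (hlim u hu))
      (hdom.mono fun x hx => hx u hu)
  obtain ⟨u₀, hu₀, hfu₀⟩ := KernelTransfer.exists_profile_pos (γ := γ) hν hC hQc hQpos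
  rw [← hf] at hfu₀
  have hcpos : 0 < ∫ u in Ioi 0, f u :=
    KernelTransfer.setIntegral_Ioi_pos_of_continuousOn hfc hfint hf0 hu₀ hfu₀
  -- conclusion
  refine ⟨∫ u in Ioi 0, f u, hcpos, ?_⟩
  have h := hT.congr' hint
  simpa only [mul_comm] using h

end Core

/-- A non-zero site of `ℤ^d` has positive `ℓ¹` norm `Σᵢ |xᵢ|`. -/
theorem KernelTransfer.sum_natAbs_pos {d : ℕ} {x : Site d} (hx : x ≠ 0) :
    0 < ∑ i, (x i).natAbs := by
  rcases Nat.eq_zero_or_pos (∑ i, (x i).natAbs) with h | h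
  · exfalso
    apply hx
    funext i
    exact Int.natAbs_eq_zero.1 ((Finset.sum_eq_zero_iff.1 h) i (Finset.mem_univ i))
  · exact h

/-- **`KernelTransfer`** (item stmt-CriticalPhenomena-8360 of route BernsteinTemperature):
`AbsMonotoneTanh → KernelLocalLimit → IsingEuclidUpgradeR2RotInvPowerLaw`, with
`2Δ = 3 - γ/ν` and `c = C ∫₀^∞ u^{γ-1-3ν} Q(u^{-ν}) du`. See the module docstring. -/
theorem kernelTransfer_proof :
    Summit.CriticalPhenomena.Ising3DConformalLimit.Theses.BernsteinTemperature.KernelTransfer := by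
  intro hAM hKLL
  -- the coefficient family and the data of the local limit theorem
  choose a ha0 hasupp hasum using hAM
  obtain ⟨ν, γ, C, A, p, Q, hν, hγ, hC, hA, hp, hQc, hQ0, hQpos, hS, hRV, hLL, htail⟩ :=
    hKLL a ha0 hasupp hasum
  -- the cofinite filter of `ℤ³`
  haveI : (cofinite : Filter (Site 3)).IsCountablyGenerated :=
    KernelTransfer.isCountablyGenerated_cofinite
  have hne : ∀ᶠ x : Site 3 in cofinite, x ≠ 0 := eventually_cofinite_ne 0
  -- hypotheses of the Abelian summation
  have hv : 0 ≤ Real.tanh (criticalBeta 3) := by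
    simpa using tanh_le_tanh (criticalBeta_nonneg 3)
  have haS : ∀ (x : Site 3) (n : ℕ), a x n ≤ ∑' y, a y n := fun x n =>
    (hS n).le_tsum x fun y _ => ha0 y n
  have hpar : ∀ (x : Site 3) (n : ℕ), ¬ Even (n + ∑ i, (x i).natAbs) → a x n = 0 :=
    fun x n h => hasupp x n (Or.inr h)
  have hzero : ∀ᶠ x : Site 3 in cofinite, a x 0 = 0 := by
    filter_upwards [hne] with x hx
    exact hasupp x 0 (Or.inl (KernelTransfer.sum_natAbs_pos hx))
  have hedge : ∀ x : Site 3, x ≠ 0 →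
      HasSum (fun n => a x n * Real.tanh (criticalBeta 3) ^ n) (criticalTwoPoint 3 x) :=
    fun x hx => KernelTransfer.hasSum_criticalTwoPoint_of_hasSum_below le_rfl hx (ha0 x) (hasum x)
  have hsum : ∀ᶠ x : Site 3 in cofinite,
      Summable fun n => a x n * Real.tanh (criticalBeta 3) ^ n := by
    filter_upwards [hne] with x hx
    exact (hedge x hx).summable
  obtain ⟨c, hc, hT⟩ := KernelTransfer.abelian_tendsto (l := (cofinite : Filter (Site 3)))
    (r := fun x : Site 3 => Real.sqrt (∑ i, ((x i : ℝ)) ^ 2))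
    (m := fun x : Site 3 => ∑ i, (x i).natAbs) (a := a) (S := fun n => ∑' y : Site 3, a y n)
    (v := Real.tanh (criticalBeta 3)) hν hγ hC hA hp hQc hQ0 hQpos hv
    (fun x => Real.sqrt_nonneg _) (KernelTransfer.tendsto_sqrt_sum_sq_cofinite 3) ha0 haS hpar
    hzero hsum hRV hLL htail
  -- conclusion: `2Δ = 3 - γ/ν`
  refine ⟨(3 - γ / ν) / 2, c, hc, hT.congr' ?_⟩
  filter_upwards [hne] with x hx
  rw [(hedge x hx).tsum_eq, show 2 * ((3 - γ / ν) / 2) = 3 - γ / ν by ring]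

end Summit.CriticalPhenomena.Ising3DConformalLimit.Theorems

end
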